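import Summits.BirchSwinnertonDyer.BirchSwinnertonDyer.Theorems.ErratumRoadFiveJetchevAtPDisplay
import Summits.BirchSwinnertonDyer.BirchSwinnertonDyer.Theorems.ErratumRoadFiveNonSurjCornerKolyJRedefinitionSharp
import Summits.BirchSwinnertonDyer.BirchSwinnertonDyer.Theorems.Rank1ResidualJetSwapLevelRaisingLiterature
import Summits.BirchSwinnertonDyer.Rank1Residual.JET.McCallumProp44ByName
import HarnessLib

/-!
# PORT 3 ↦ p, target (α) (crux `EulerHalfNotRamNoInertSetAtFive`, item stmt-BirchSwinnertonDyer-19715, line `birth` v5 → v6; RULING 53 (3)):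
# Jetchev's Thm. 1.4 (max form) READ AT THE MULTIPLICATIVE BSD PRIME p ITSELF, modulo FIVE printed facts —
# McCallum 1991 Prop. 5.2 (`h52`) STRUCK: Kolyvagin's redefinition of `m_∞` is bsd-jet's KERNEL prime swap

Cell `bsd-stepL`, seat `bsd-line-er5-p1-w2` (D-0154 width seat -w2; lead `bsd-line-er5-p1`, who assigned target (α) 08:07:45Z),
`--supports stmt-BirchSwinnertonDyer-19715` (helper). THEOREMS ONLY; namespace `…X11b.AtP.Koly` (P3). The p = 3 originals (NOT edited):
tam3-p1 g10's `Three.Koly.hlevAtThree_of_prop44_of_poitouTate_of_Gross1991` ∕ `Three.Koly.jetchevMaxHLAtThree_of_swapLiterature`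
(`…ClassRecordThreeEulerHalvesAtThreeJetchevMaxOfSwapLiterature.lean`) and corner-p1's `Three.Koly.jetchevMaxHLAtThree_of_swap_of_perLevel'`
(`…JetchevMaxOfSwapSharp.lean`). PORT RULE (P2): `3 ↦ (p : ℕ) [Fact p.Prime]`, weakest side condition `p ≠ 2`; every frame binder carries
`Odd d_K → d_K ≠ −3` (the P1 certificate's only non-parametric step; at 3 it came from «3 split in K»); the rest is the original text.
The kernel inputs are ALREADY p-generic: bsd-jet's `JET.Swap.levelRaising_of_literature hPT hF1 h372` (McCallum's proof of Prop. 5.2, case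
`C = {0}`, at level `p` on the root classes), corner-p1's frame-free `Three.Koly.pDiv_of_swap_of_perLevel p`, bsd-jet's
`JET.prop44_of_frobeniusCongruence`, and this seat's layers 2a ∕ 2b (`selmerSupplyAtP_of_poitouTate_Gross1991`, p613446; the §6 walk, p614031).

* `hlevAtP_of_prop44_of_poitouTate_of_Gross1991` — the per-level inequality `hlev` at the frames, general odd `p`, STANDALONE (the walk block of
  layer 2b's `jetchevMaxHLAtP_of_facts_of_print` byte for byte; inputs `h44 hGZ hmod hPT hF1`).
  -- adapted from Summits/BirchSwinnertonDyer/BirchSwinnertonDyer/Theorems/ClassRecordThreeEulerHalvesAtThreeJetchevMaxOfSwapLiterature.lean (§1)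
* `jetchevMaxHLAtP_of_swap_of_perLevel'` — HL at `p` ⟸ {hswap, hlev} (no finiteness ∕ Prop. 5.2 ∕ Gross–Zagier input).
  -- adapted from Summits/BirchSwinnertonDyer/BirchSwinnertonDyer/Theorems/ClassRecordThreeEulerHalvesAtThreeJetchevMaxOfSwapSharp.lean
* **`jetchevMaxHLAtP_of_swapLiterature (p) (hp2 : p ≠ 2) (h372 hGZ hmod hPT hF1)`** — TARGET (α): HL at a general odd `p` (the conclusion shape
  of layer 2b's (A), frame binder `d_K ≠ −3`) from FIVE printed facts {Gross 1991 Prop. 3.7 (2) image-free `h372`, Gross–Zagier, modularity,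
  Poitou–Tate for Selmer structures, Gross 1991 §6} — `h52` gone, `h44 := JET.prop44_of_frobeniusCongruence h372`.
  -- adapted from Summits/BirchSwinnertonDyer/BirchSwinnertonDyer/Theorems/ClassRecordThreeEulerHalvesAtThreeJetchevMaxOfSwapLiterature.lean (§2)
* `jetchevMaxHLAtP_of_swapPrint` — the same in skeleton v5's packaging (`5 ≤ p` prepended, `d_K < −4` frame hypothesis, facts as leading
  hypotheses `h372 → hGZ → hmod → hPT → hF1 → …`): the TYPE a v6 deciding stub can be registered at (RULING 53 (3): `stub_printFactsHeld` drops its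
  conjunct (1) McCallum Prop. 5.2) — neutral name; LEAD ∕ planner type v6 off it.

HONEST FRAMING: CONDITIONAL on the five displayed named facts (cite-only hypotheses; `hPT` typed-not-proved; flag Kolyvagin1991-LNM1479-primary-unread
(r2) inherited through the kernel's McCallum reading; McCallum's tower-surjectivity reading discharged by `forall_hasSurjectiveModNGaloisRep_pow_of_multiplicative_of_surj`);
NO schema, NO `sorry`, NO definition, NO new named fact; nothing booked; no census label moves (T7); no stub of 19715 is closed by this file
(v5's deciding stub keeps `h52`; v6 is the planner's registration); BSD(E, p) is proved for NO pair by this file and no summit statement is proved by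
this seat.
[cite: Jetchev2008, Thm. 1.4 (p. 812), Lemma 5.1, Prop. 5.3, Proof of Thm. 1.1 (pp. 820–824)] [cite: McCallumLMS1991, §4 Prop. 4.4, §5 Prop. 5.2 and proof (pp. 304–306)]
[cite: GrossLMS1991, Prop. 3.7 (2), §5 Prop. 5.3, §6 Prop. 6.2 (1)] [cite: GrossZagier1986, I (6.3), III (3.1)] [cite: MilneADT2006, Ch. I, Thm. 4.10(b)]
[cite: Nekovar2007, Prop. 4.13 (ii)]
-/

set_option autoImplicit false

noncomputable section

open scoped Classical NumberField

namespace Summit.BirchSwinnertonDyer.Rank1Residual.X11b.AtP.Koly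

open WeierstrassCurve IsDedekindDomain NumberField Field Literature.NumberTheory.EllipticCurves
  Literature.NumberTheory.EllipticCurves.ModularForms Literature.NumberTheory.EllipticCurves.Jetchev2008
  Literature.NumberTheory.EllipticCurves.KolyvaginCocycle
  Literature.NumberTheory.EllipticCurves.Rank1Residual Literature.NumberTheory.GaloisRepresentations
  Literature.NumberTheory.GaloisRepresentations.DiscreteGaloisModule
  Literature.NumberTheory.GaloisCohomology Literature.NumberTheory.Automorphic
  Summit.BirchSwinnertonDyer.Rank1Residual.X11b Summit.BirchSwinnertonDyer.Rank1Residual.JET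
  Summit.BirchSwinnertonDyer.Rank1Residual.X11b.Three.Koly

/-! ### §1 The per-level inequality `hlev` at the frames, general odd `p`, standalone -/

/-- **The per-level inequality `hlev` at the frames of HL(`p`)** (Jetchev 2008 §6: the WALK Prop. 6.4 ∘ Thm. 6.3 on the row objects at level `p^k`:
«`m(n) < k`, `ord_p c_v ≤ k`, `k + m(n) ≤ M(n)` ⟹ `ord_p c_v ≤ m(n)`» for every admissible `(n, d)`), general odd `p`, STANDALONE, modulo the
named Literature facts {McCallum Prop. 4.4, Gross–Zagier, modularity, Poitou–Tate for Selmer structures, Gross 1991 §6 ∕ [GZ86 III (3.1)]} — the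
walk block of layer 2b's `jetchevMaxHLAtP_of_facts_of_print` (p614031) byte for byte (port of tam3-p1 g10's
`Three.Koly.hlevAtThree_of_prop44_of_poitouTate_of_Gross1991`, `3 ↦ p`, frame binder `d_K ≠ −3`). CONDITIONAL; nothing asserted about any curve.
[cite: Jetchev2008, Lemma 5.1, Prop. 5.3, Thm. 5.2, Proof of Thm. 1.1 (pp. 820–824)] [cite: McCallumLMS1991, §4 Prop. 4.4]
[cite: GrossLMS1991, §5 Prop. 5.3, §6 Prop. 6.2 (1)] [cite: GrossZagier1986, III (3.1)] [cite: MilneADT2006, Ch. I, Thm. 4.10(b)] -/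
theorem hlevAtP_of_prop44_of_poitouTate_of_Gross1991 (p : ℕ) [Fact p.Prime] (hp2 : p ≠ 2)
    (h44 : McCallum1991.prop44_localOrder_kolyvaginClass_mul_eq)
    (hGZ : ∀ (N : ℕ) [NeZero N] (W : WeierstrassCurve ℚ) (K : Type) [Field K] [NumberField K],
      gross_zagier N W K)
    (hmod : hasEntireLFunction_rat)
    (hPT : ∀ (K : Type) [Field K] [NumberField K], poitouTate_selmerStructure_duality_conj K)
    (hF1 : Gross1991_heegnerPoint_sub_ratTorsion_mem_E0) :
    ∀ (W : WeierstrassCurve ℚ) [W.IsElliptic] [W.IsGloballyMinimal] [NeZero (W.conductorNorm ℤ)]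
      (K : Type) [Field K] [NumberField K]
      (Dt : ModularParametrizationData W (W.conductorNorm ℤ)) (β : ℤ) (ι : K →+* ℂ),
      W.analyticRank = 1 → W.HasMultiplicativeReductionAtPrime p → Surj W p →
      IsImaginaryQuadratic K → SatisfiesHeegnerHypothesis (W.conductorNorm ℤ) K →
      Odd (NumberField.discr K) → NumberField.discr K ≠ -3 →
      (W.quadraticTwist (NumberField.discr K : ℚ)).entireLFunction 1 ≠ 0 →
      (4 * (W.conductorNorm ℤ : ℤ)) ∣ β ^ 2 - NumberField.discr K → ¬ (p : ℤ) ∣ Dt.c →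
      ∀ (v : HeightOneSpectrum (𝓞 ℚ)) (k n : ℕ) (d : KolyvaginHeegnerData Dt β ι n), Squarefree n →
        (∀ ℓ ∈ n.primeFactors, Zhang2014.IsKolyvaginPrime (W.conductorNorm ℤ) W K p ℓ) →
        (if divOrd d p < Zhang2014.levelIndex W p n then divOrd d p else (⊤ : ℕ∞)) < (k : ℕ∞) →
        padicValNat p (W.tamagawaNumberAt v) ≤ k →
        (k : ℕ∞) + (if divOrd d p < Zhang2014.levelIndex W p n then divOrd d p else ⊤) ≤
          Zhang2014.levelIndex W p n →
        (padicValNat p (W.tamagawaNumberAt v) : ℕ∞) ≤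
          (if divOrd d p < Zhang2014.levelIndex W p n then divOrd d p else ⊤) := by
  -- adapted from Summits/BirchSwinnertonDyer/BirchSwinnertonDyer/Theorems/ClassRecordThreeEulerHalvesAtThreeJetchevMaxOfSwapLiterature.lean
  intro W _ _ _ K _ _ Dt β ι hr hmult hρ hK hHN hodd hD3 hLt hβ hc3 v k n d hsq hkol h1 h2 h3
  -- `k ≥ 1` and the admissibility of `n` at level `k`
  have hk : 1 ≤ k := by
    rcases Nat.eq_zero_or_pos k with rfl | hk
    · exact absurd h1 (by simp)
    · exact hk
  have hkM : (k : ℕ∞) ≤ Zhang2014.levelIndex W p n := le_trans le_self_add h3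
  have hn : Squarefree n ∧ ∀ q ∈ n.primeFactors,
      Zhang2014.IsKolyvaginPrime (W.conductorNorm ℤ) W K p q ∧ k ≤ Zhang2014.kolyvaginIndex W p q :=
    ⟨hsq, fun q hq ↦ ⟨hkol q hq, Zhang2014.natCast_le_levelIndex_iff.mp hkM q hq⟩⟩
  -- frame facts: complex conjugation, `(N, d_K) = 1`, `d_K < -4`
  obtain ⟨τ, hτ⟩ := exists_algEquiv_ne_one_of_isImaginaryQuadratic K hK
  have hND : IsCoprime ((W.conductorNorm ℤ : ℕ) : ℤ) (NumberField.discr K) :=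
    KolyvaginAssembly.isCoprime_discr_of_satisfiesHeegnerHypothesis hK hHN
  have hD : NumberField.discr K < -4 := by
    have hneg : NumberField.discr K < 0 := hK.discr_neg
    have h4 : NumberField.discr K % 4 = 0 ∨ NumberField.discr K % 4 = 1 :=
      Literature.NumberTheory.QuadraticFields.Quadratic.discr_emod_four (K := K) hK.1
    obtain ⟨r, hr⟩ := hodd
    omega
  -- Gross's one system of choices extending `d`, and Prop. 4.7 for it (from `h44`)
  have hcm : ¬ W.HasCM := not_hasCM_of_hasMultiplicativeReductionAtPrime' W hmult
  have htower : ∀ j : ℕ, W.HasSurjectiveModNGaloisRep (p ^ j : ℕ) :=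
    forall_hasSurjectiveModNGaloisRep_pow_of_multiplicative_of_surj W p hp2 hmult hρ
  obtain ⟨D, hDd, h47⟩ := exists_data_h47Base_of_prop44 h44 W hcm hK hD hHN (p := p) hp2 htower
    Dt β ι hk hn d
  -- the sign `ε := −w(E)`, a sign function for it, and Gross Prop. 5.3 for the data — UNCONDITIONAL
  -- (bsd-jet reader 1's `JET.exists_mem_ringClassGal_isOfFinAddOrder_conj_sub_smul`: Shimura reciprocity
  -- at conductor `m` + x11b3's `KolyvaginA53.h53_of_recM`; admissible conductors are `≠ 0`, prime to `N`)
  have hε : (-W.rootNumber : ℤ) = 1 ∨ (-W.rootNumber : ℤ) = -1 := by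
    rcases W.rootNumber_eq_one_or with h | h <;> simp [h]
  obtain ⟨eb, heb, hebε⟩ := Walk.exists_signFunction (-W.rootNumber) hε
  have h53D : ∀ (s s' : {m : ℕ // Squarefree m ∧ ∀ q ∈ m.primeFactors,
        Zhang2014.IsKolyvaginPrime (W.conductorNorm ℤ) W K p q ∧ k ≤ Zhang2014.kolyvaginIndex W p q})
      (_ : s'.1 ∣ s.1) (τm : ringClassField K ι s'.1 ≃ₐ[ℚ] ringClassField K ι s'.1),
      (∀ x : ringClassField K ι s'.1, ((τm x : ringClassField K ι s'.1) : ℂ) = starRingEnd ℂ x) →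
      ∃ σ' ∈ ringClassGal ι s'.1, IsOfFinAddOrder
        (pointGalHom W (ringClassField K ι s'.1) τm (D s').y -
          (-W.rootNumber) • pointGalHom W (ringClassField K ι s'.1) σ' (D s').y) := by
    intro s s' _ τm hτm
    obtain ⟨hm0, hmN⟩ := ne_zero_and_coprime_of_isKolyvaginPrime (K := K) s'.2.1
      (fun q hq ↦ (s'.2.2 q hq).1)
    exact exists_mem_ringClassGal_isOfFinAddOrder_conj_sub_smul W hK hHN Dt ι hm0 hmN (D s') τm hτm
  -- the supply at this frame, for these data and signs
  obtain ⟨𝒯, 𝒮, Qcar, C', hS, hQcar, hdisj, hPT, hselmer, hC, hdual_q, hsel0, hdual_ℓ⟩ :=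
    selmerSupplyAtP_of_poitouTate_Gross1991 p hp2 hPT hF1 W K Dt β ι hr hmult hρ hK hHN hodd hD3 hLt hβ hc3 τ hτ
      v k hk h2 n d hn D hDd (-W.rootNumber) hε eb heb hebε
  have h49 := h49_of_selmerMembership W hK hND hD (p := p) hp2 hρ Dt β ι hτ hk 𝒯 𝒮 Qcar D eb
    (-W.rootNumber) hebε h53D n hsel0
  have hordκ := hordκ_of_admissibleData W hK hND hD (p := p) hp2 hρ Dt β ι k D
  have hdivfin := fun s ↦ divOrd_ne_top_of_levelIndex_eq_top p W K
    (heegnerPointOfConductor_one_galoisConj_holds _ W K) (hGZ _ W K) hmod Dt β ι hr hK hHN hLt s (D s)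
  have hfin := JET.Walk.hfin_of_kummer (K := K) W (Fact.out : p.Prime) k 𝒯
  have hκt := hκt_of_selmerMembership W hK hND hD (p := p) hp2 hρ Dt β ι hτ hk 𝒯 D eb
    (-W.rootNumber) hebε h53D hdivfin hselmer
  have key := tamagawaExponent_le_m_of_orderedFamiliesBase W K hK p hp2 hρ Dt β ι τ hτ k
    (padicValNat p (W.tamagawaNumberAt v)) hk h2 𝒯 𝒮 hS Qcar hQcar D eb heb n hn ?_ ?_ hdisj hfin hPT
    (fun s _ ↦ hκt s) hordκ h47 C' hC hdual_q h49 hdual_ℓ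
  · rw [hDd] at key
    exact key
  · rw [hDd]; exact h1
  · rw [hDd]; exact h3


/-! ### §2 HL at `p` from the swap supply and the per-level inequality alone -/

/-- **HL at a general `p` ⟸ {hswap, hlev}** — no finiteness, McCallum-5.2 or Gross–Zagier input: corner-p1's frame-free
`Three.Koly.pDiv_of_swap_of_perLevel p` at each frame (port of `Three.Koly.jetchevMaxHLAtThree_of_swap_of_perLevel'`, `3 ↦ p`, frame binder
`d_K ≠ −3`). CONDITIONAL; nothing booked. [cite: Jetchev2008, Thm. 1.4 (p. 812)] [cite: McCallumLMS1991, §5 Prop. 5.2 (p. 304)]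
[cite: BurungaleEtAl2026, Prop. 2.2.1 (§2.2)] -/
theorem jetchevMaxHLAtP_of_swap_of_perLevel' (p : ℕ) [Fact p.Prime]
    (hswap :
      ∀ (W : WeierstrassCurve ℚ) [W.IsElliptic] [W.IsGloballyMinimal] [NeZero (W.conductorNorm ℤ)]
      (K : Type) [Field K] [NumberField K]
      (Dt : ModularParametrizationData W (W.conductorNorm ℤ)) (β : ℤ) (ι : K →+* ℂ),
      W.analyticRank = 1 → W.HasMultiplicativeReductionAtPrime p → Surj W p →
      IsImaginaryQuadratic K → SatisfiesHeegnerHypothesis (W.conductorNorm ℤ) K →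
      Odd (NumberField.discr K) → NumberField.discr K ≠ -3 →
      (W.quadraticTwist (NumberField.discr K : ℚ)).entireLFunction 1 ≠ 0 →
      (4 * (W.conductorNorm ℤ : ℤ)) ∣ β ^ 2 - NumberField.discr K → ¬ (p : ℤ) ∣ Dt.c →
      ∀ (M e : ℕ) (n : ℕ) (d : KolyvaginHeegnerData Dt β ι n), Squarefree n →
        (∀ ℓ ∈ n.primeFactors, Zhang2014.IsKolyvaginPrime (W.conductorNorm ℤ) W K p ℓ ∧
          M + 1 ≤ Zhang2014.kolyvaginIndex W p ℓ) →
        (∀ (n' : ℕ) (d' : KolyvaginHeegnerData Dt β ι n'), Squarefree n' →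
          (∀ ℓ ∈ n'.primeFactors, Zhang2014.IsKolyvaginPrime (W.conductorNorm ℤ) W K p ℓ ∧
            M + 1 ≤ Zhang2014.kolyvaginIndex W p ℓ) → PDiv d' p M) →
        ¬ PDiv d p (M + 1) →
        ∃ (n' : ℕ) (d' : KolyvaginHeegnerData Dt β ι n'), Squarefree n' ∧
          (∀ ℓ ∈ n'.primeFactors, Zhang2014.IsKolyvaginPrime (W.conductorNorm ℤ) W K p ℓ ∧
            e ≤ Zhang2014.kolyvaginIndex W p ℓ) ∧ ¬ PDiv d' p (M + 1))
    (hlev :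
      ∀ (W : WeierstrassCurve ℚ) [W.IsElliptic] [W.IsGloballyMinimal] [NeZero (W.conductorNorm ℤ)]
      (K : Type) [Field K] [NumberField K]
      (Dt : ModularParametrizationData W (W.conductorNorm ℤ)) (β : ℤ) (ι : K →+* ℂ),
      W.analyticRank = 1 → W.HasMultiplicativeReductionAtPrime p → Surj W p →
      IsImaginaryQuadratic K → SatisfiesHeegnerHypothesis (W.conductorNorm ℤ) K →
      Odd (NumberField.discr K) → NumberField.discr K ≠ -3 →
      (W.quadraticTwist (NumberField.discr K : ℚ)).entireLFunction 1 ≠ 0 →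
      (4 * (W.conductorNorm ℤ : ℤ)) ∣ β ^ 2 - NumberField.discr K → ¬ (p : ℤ) ∣ Dt.c →
      ∀ (v : HeightOneSpectrum (𝓞 ℚ)) (k n : ℕ) (d : KolyvaginHeegnerData Dt β ι n), Squarefree n →
        (∀ ℓ ∈ n.primeFactors, Zhang2014.IsKolyvaginPrime (W.conductorNorm ℤ) W K p ℓ) →
        (if divOrd d p < Zhang2014.levelIndex W p n then divOrd d p else (⊤ : ℕ∞)) < (k : ℕ∞) →
        padicValNat p (W.tamagawaNumberAt v) ≤ k →
        (k : ℕ∞) + (if divOrd d p < Zhang2014.levelIndex W p n then divOrd d p else ⊤) ≤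
          Zhang2014.levelIndex W p n →
        (padicValNat p (W.tamagawaNumberAt v) : ℕ∞) ≤
          (if divOrd d p < Zhang2014.levelIndex W p n then divOrd d p else ⊤)) :
      ∀ (W : WeierstrassCurve ℚ) [W.IsElliptic] [W.IsGloballyMinimal] [NeZero (W.conductorNorm ℤ)]
        (K : Type) [Field K] [NumberField K]
        (Dt : ModularParametrizationData W (W.conductorNorm ℤ)) (β : ℤ) (ι : K →+* ℂ),
        W.analyticRank = 1 → W.HasMultiplicativeReductionAtPrime p → Surj W p →
        IsImaginaryQuadratic K → SatisfiesHeegnerHypothesis (W.conductorNorm ℤ) K →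
        Odd (NumberField.discr K) → NumberField.discr K ≠ -3 →
        (W.quadraticTwist (NumberField.discr K : ℚ)).entireLFunction 1 ≠ 0 →
        (4 * (W.conductorNorm ℤ : ℤ)) ∣ β ^ 2 - NumberField.discr K → ¬ (p : ℤ) ∣ Dt.c →
        ∀ (v : HeightOneSpectrum (𝓞 ℚ)) (s : ℕ), s ≤ padicValNat p (W.tamagawaNumberAt v) →
          ∀ (n : ℕ) (d : KolyvaginHeegnerData Dt β ι n), Squarefree n →
            (∀ ℓ ∈ n.primeFactors, Zhang2014.IsKolyvaginPrime (W.conductorNorm ℤ) W K p ℓ ∧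
              s ≤ Zhang2014.kolyvaginIndex W p ℓ) → PDiv d p s := by
  -- adapted from Summits/BirchSwinnertonDyer/BirchSwinnertonDyer/Theorems/ClassRecordThreeEulerHalvesAtThreeJetchevMaxOfSwapSharp.lean
  intro W _ _ _ K _ _ Dt β ι hr hmult hρ hK' hHN hodd hD3 hLt hβ hc v s hs n d hn hℓ
  exact pDiv_of_swap_of_perLevel p (padicValNat p (W.tamagawaNumberAt v))
    (hswap W K Dt β ι hr hmult hρ hK' hHN hodd hD3 hLt hβ hc)
    (fun k n d hn' hℓ' h1 h2 h3 => hlev W K Dt β ι hr hmult hρ hK' hHN hodd hD3 hLt hβ hc v k n d hn' hℓ' h1 h2 h3)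
    s hs n d hn hℓ

/-! ### §3 TARGET (α): HL at a general odd `p` modulo FIVE printed facts — McCallum Prop. 5.2 struck -/

/-- **HL at a general odd `p` (Jetchev's Thm. 1.4, max form, READ at `p ∥ N`, carrier `v = (p)` allowed) MODULO FIVE named Literature facts**
{Gross 1991 Prop. 3.7 (2) image-free `h372`, Gross–Zagier `hGZ`, modularity `hmod`, Poitou–Tate for Selmer structures `hPT`, Gross 1991 §6 ∕
[GZ86 III (3.1)] `hF1`} — McCallum 1991 Prop. 5.2 REPLACED by cell bsd-jet's kernel prime swap `JET.Swap.levelRaising_of_literature hPT hF1 h372`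
(transported to the frame: `¬CM` ⟸ multiplicative at `p`; the `p`-adic tower ⟸ `Surj W p` ∧ multiplicative at the odd `p`; `d_K ≠ −4` ⟸ `d_K` odd;
`d_K ≠ −3` = the frame binder; `1 + M` ↔ `M + 1`; target index `e ≤ max e (1+M)`) and Prop. 4.4 by `JET.prop44_of_frobeniusCongruence h372`;
composition = §2 with hlev := §1. Port of tam3-p1 g10's `Three.Koly.jetchevMaxHLAtThree_of_swapLiterature` (`3 ↦ p`, `p ≠ 2`). Conclusion shape
= layer 2b's (A) `jetchevMaxHLAtP_of_facts_of_print` VERBATIM (so every consumer of (A) re-keys). CONDITIONAL, nothing asserted about any curve.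
[cite: Jetchev2008, Thm. 1.4 (p. 812), Proof of Thm. 1.1 (pp. 820–824)] [cite: McCallumLMS1991, §4 Prop. 4.4, §5 Prop. 5.2 and proof (pp. 304–306)]
[cite: GrossLMS1991, Prop. 3.7 (2), §5 Prop. 5.3, §6 Prop. 6.2 (1)] [cite: GrossZagier1986, I (6.3), III (3.1)] [cite: MilneADT2006, Ch. I, Thm. 4.10(b)] -/
theorem jetchevMaxHLAtP_of_swapLiterature (p : ℕ) [Fact p.Prime] (hp2 : p ≠ 2)
    -- NAMED LITERATURE FACTS (cite-only)
    (h372 : GrossLMS1991.prop37_2_frobeniusCongruence)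
    (hGZ : ∀ (N : ℕ) [NeZero N] (W : WeierstrassCurve ℚ) (K : Type) [Field K] [NumberField K],
      gross_zagier N W K)
    (hmod : hasEntireLFunction_rat)
    (hPT : ∀ (K : Type) [Field K] [NumberField K], poitouTate_selmerStructure_duality_conj K)
    (hF1 : Gross1991_heegnerPoint_sub_ratTorsion_mem_E0) :
    ∀ (W : WeierstrassCurve ℚ) [W.IsElliptic] [W.IsGloballyMinimal] [NeZero (W.conductorNorm ℤ)]
      (K : Type) [Field K] [NumberField K]
      (Dt : ModularParametrizationData W (W.conductorNorm ℤ)) (β : ℤ) (ι : K →+* ℂ),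
      W.analyticRank = 1 → W.HasMultiplicativeReductionAtPrime p → Surj W p →
      IsImaginaryQuadratic K → SatisfiesHeegnerHypothesis (W.conductorNorm ℤ) K →
      Odd (NumberField.discr K) → NumberField.discr K ≠ -3 →
      (W.quadraticTwist (NumberField.discr K : ℚ)).entireLFunction 1 ≠ 0 →
      (4 * (W.conductorNorm ℤ : ℤ)) ∣ β ^ 2 - NumberField.discr K → ¬ (p : ℤ) ∣ Dt.c →
      ∀ (v : HeightOneSpectrum (𝓞 ℚ)) (s : ℕ), s ≤ padicValNat p (W.tamagawaNumberAt v) →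
        ∀ (n : ℕ) (d : KolyvaginHeegnerData Dt β ι n), Squarefree n →
          (∀ ℓ ∈ n.primeFactors, Zhang2014.IsKolyvaginPrime (W.conductorNorm ℤ) W K p ℓ ∧
            s ≤ Zhang2014.kolyvaginIndex W p ℓ) → PDiv d p s := by
  -- adapted from Summits/BirchSwinnertonDyer/BirchSwinnertonDyer/Theorems/ClassRecordThreeEulerHalvesAtThreeJetchevMaxOfSwapLiterature.lean
  have hp : p.Prime := Fact.out
  refine jetchevMaxHLAtP_of_swap_of_perLevel' p ?_
    (hlevAtP_of_prop44_of_poitouTate_of_Gross1991 p hp2 (prop44_of_frobeniusCongruence h372) hGZ hmod hPT hF1)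
  intro W _ _ _ K _ _ Dt β ι hr hmult hρ hK hHN hodd hD3 hLt hβ hc3 M e n d hsq hnK hall hnd
  -- frame facts: `¬CM`, the `p`-adic tower, `d_K ≠ −4`
  have hcm : ¬ W.HasCM := not_hasCM_of_hasMultiplicativeReductionAtPrime' W hmult
  have htower : ∀ j : ℕ, W.HasSurjectiveModNGaloisRep (p ^ j : ℕ) :=
    forall_hasSurjectiveModNGaloisRep_pow_of_multiplicative_of_surj W p hp2 hmult hρ
  have hneg : NumberField.discr K < 0 := hK.discr_neg
  have hD4 : NumberField.discr K ≠ -4 := by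
    have h4 : NumberField.discr K % 4 = 0 ∨ NumberField.discr K % 4 = 1 :=
      Literature.NumberTheory.QuadraticFields.Quadratic.discr_emod_four (K := K) hK.1
    obtain ⟨r, hr⟩ := hodd
    omega
  -- `M + 1` versus `1 + M` in the admissibility clauses
  have hidx : ∀ {c : ℕ}, (∀ q ∈ c.primeFactors, Zhang2014.IsKolyvaginPrime (W.conductorNorm ℤ) W K p q ∧
      1 + M ≤ Zhang2014.kolyvaginIndex W p q) → ∀ q ∈ c.primeFactors,
      Zhang2014.IsKolyvaginPrime (W.conductorNorm ℤ) W K p q ∧ M + 1 ≤ Zhang2014.kolyvaginIndex W p q :=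
    fun h q hq ↦ ⟨(h q hq).1, by rw [Nat.add_comm]; exact (h q hq).2⟩
  -- Kolyvagin's prime swap in the kernel (cell bsd-jet), fed by the three named statements
  obtain ⟨n', d', hn', hn'K, hnd'⟩ := Swap.levelRaising_of_literature hPT hF1 h372 W hcm K hK hD3 hD4 hHN
    p hp2 htower Dt β ι M (fun c hc hcK dc ↦ hall c dc hc (hidx hcK)) n hsq
    (fun q hq ↦ ⟨(hnK q hq).1, by rw [Nat.add_comm]; exact (hnK q hq).2⟩) d hnd e
  exact ⟨n', d', hn', fun q hq ↦ ⟨(hn'K q hq).1, le_trans (le_max_left _ _) (hn'K q hq).2⟩, hnd'⟩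

/-! ### §4 The same in skeleton v5's packaging (`5 ≤ p`, `d_K < −4`; facts as leading hypotheses) — the type a v6 deciding stub can sit at -/

/-- **HL at `p ≥ 5` modulo the five printed facts, in the deciding stub's packaging** (v5 :100 with its two McCallum hypotheses
`h52 → h44 →` replaced by the single image-free Gross 1991 Prop. 3.7 (2) `h372 →`; `5 ≤ p` prepended, `d_K < −4` a frame hypothesis): for every
globally minimal `W` with `r_an = 1`, multiplicative at `p ≥ 5`, `ρ̄_{E,p}` onto, every imaginary quadratic Heegner `K` with `d_K` odd, `d_K < −4`,
`L(E^{d_K},1) ≠ 0`, every Manin-good conductor-1 frame, every finite place `v`, `s ≤ ord_p c_v(E)`, every squarefree Kolyvagin level `n` of index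
`≥ s`: `PDiv d p s`. Wrapper over §3 (`5 ≤ p` gives `p ≠ 2`, `d_K < −4` gives `d_K ≠ −3`). Neutral name: v6's deciding stub (RULING 53 (3)) is the
planner's registration. CONDITIONAL on the five facts; nothing booked.
[cite: Jetchev2008, Thm. 1.4 (p. 812) and Cor. 1.5] [cite: GrossLMS1991, Prop. 3.7 (2), §6 Prop. 6.2 (1)] [cite: MilneADT2006, Ch. I, Thm. 4.10(b)] -/
theorem jetchevMaxHLAtP_of_swapPrint :
    Literature.NumberTheory.EllipticCurves.GrossLMS1991.prop37_2_frobeniusCongruence →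
    (∀ (N : ℕ) [NeZero N] (W : WeierstrassCurve ℚ) (K : Type) [Field K] [NumberField K],
      Literature.NumberTheory.EllipticCurves.gross_zagier N W K) →
    WeierstrassCurve.hasEntireLFunction_rat →
    (∀ (K : Type) [Field K] [NumberField K], Literature.NumberTheory.GaloisCohomology.poitouTate_selmerStructure_duality_conj K) →
    Literature.NumberTheory.EllipticCurves.Gross1991_heegnerPoint_sub_ratTorsion_mem_E0 →
    ∀ (W : WeierstrassCurve ℚ) [W.IsElliptic] [W.IsGloballyMinimal] (p : ℕ) [Fact p.Prime]
      [NeZero (W.conductorNorm ℤ)] (K : Type) [Field K] [NumberField K]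
      (Dt : Literature.NumberTheory.EllipticCurves.ModularForms.ModularParametrizationData W (W.conductorNorm ℤ)) (β : ℤ) (ι : K →+* ℂ),
      5 ≤ p → W.analyticRank = 1 → W.HasMultiplicativeReductionAtPrime p → Literature.NumberTheory.EllipticCurves.Rank1Residual.Surj W p →
      Literature.NumberTheory.EllipticCurves.IsImaginaryQuadratic K →
      Literature.NumberTheory.EllipticCurves.SatisfiesHeegnerHypothesis (W.conductorNorm ℤ) K →
      Odd (NumberField.discr K) → NumberField.discr K < -4 →
      (W.quadraticTwist (NumberField.discr K : ℚ)).entireLFunction 1 ≠ 0 →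
      (4 * (W.conductorNorm ℤ : ℤ)) ∣ β ^ 2 - NumberField.discr K → ¬ (p : ℤ) ∣ Dt.c →
      ∀ (v : IsDedekindDomain.HeightOneSpectrum (NumberField.RingOfIntegers ℚ)) (s : ℕ), s ≤ padicValNat p (W.tamagawaNumberAt v) →
        ∀ (n : ℕ) (d : Literature.NumberTheory.EllipticCurves.KolyvaginHeegnerData Dt β ι n), Squarefree n →
          (∀ ℓ ∈ n.primeFactors, Literature.NumberTheory.EllipticCurves.Zhang2014.IsKolyvaginPrime (W.conductorNorm ℤ) W K p ℓ ∧
            s ≤ Literature.NumberTheory.EllipticCurves.Zhang2014.kolyvaginIndex W p ℓ) →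
          Summit.BirchSwinnertonDyer.Rank1Residual.X11b.Three.Koly.PDiv d p s := by
  intro h372 hGZ hmod hPT hF1 W _ _ p _ _ K _ _ Dt β ι hp5 hr hmult hρ hK hHN hodd hD4 hLt hβ hc v s hs n d hsq hkol
  have hp2 : p ≠ 2 := by omega
  have hD3 : NumberField.discr K ≠ -3 := by omega
  exact jetchevMaxHLAtP_of_swapLiterature p hp2 h372 hGZ hmod hPT hF1 W K Dt β ι hr hmult hρ hK hHN hodd hD3 hLt hβ hc v s
    hs n d hsq hkol

end Summit.BirchSwinnertonDyer.Rank1Residual.X11b.AtP.Koly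

end
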